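import Mathlib
import Summits.MatrixMultiplication.MatrixMultiplication.Theses.FidelityWitnesses
import Summits.MatrixMultiplication.MatrixMultiplication.Theorems.FidelityWitnessesSevenEighthsLawStubSliceElimination

/-!
# `FidelityWitnesses.SixEighthsAtFive` on the rank-one-slot strata: no super-additivity

Support file for item `stmt-MatrixMultiplication-14040` (`SixEighthsAtFive`, `M(2,5) ≤ 6`) of route
`MatrixMultiplication/FidelityWitnesses`.  Slots as in the tree: `S a b c`, `a = (κ,ν)` output,
`b = (κ,μ)`, `c = (μ,ν)`, `T = matMulTensor ℂ 2 2 2`.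

THEOREM (support bound).  If `S = Σ_{s ∈ σ} w_s ⊗ u_s ⊗ (p_s ⊗ q_s)` is ANY finite sum of triads whose
THIRD factors are rank-one `2 × 2` matrices `c ↦ p_s c.1 · q_s c.2` (the first two factors arbitrary),
then `|⟨S, ⟨2,2,2⟩⟩|² ≤ |σ| · ‖S‖²` (`overlap_sq_le_card_of_rankOne_c`).  The same holds for the second
slot (`…_rankOne_b`) and for the output slot (`…_rankOne_a`), by the cyclic symmetry
`S ↦ S(b.swap, c, a.swap)` of `⟨2,2,2⟩` (`overlap_cycle`, `normSq_cycle`).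

CONSEQUENCES for the item. (i) Every tensor of rank `≤ 5` one of whose slots consists of rank-`≤ 1`
matrices satisfies the item's inequality with `5` in place of `6`; (ii) more generally (splitting a
rank-2 factor into two rank-one pieces doubles its count) the item's inequality `≤ 6‖S‖²` holds for
every rank-5 decomposition having a slot with AT MOST ONE factor of rank `2`
(`sixEighthsAtFive_of_atMostOneFullRank_c/_b/_a`).  Bini's honest family `bini5S m` (crux disproof
file of `LinearDefectLaw`, Landsberg 2017 (2.1.2)) is exactly of this kind in its `X`-slot (the middle
slot: four rank-one factors and `a₁₂ + a₂₁`), so the constant `6` of (ii) is TIGHT (ratio `36m²/(6m²+4) ↑ 6`);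
the near-maximisers found numerically (this seat, NOTES.md) have four or five nearly rank-one factors in
a slot.  What remains open for the item is therefore the regime where EVERY slot carries at least two
factors of rank `2` (and no slot lies in a hyperplane, p93453).

PROOF (exact output elimination + a support frame).  With `g_s(b, ν) := u_s b · q_s ν` let
`Y := span{g_s} ⊂ ℂ^{P2 × Fin 2}`, `d := dim Y ≤ |σ|`, `y_1 … y_d` an orthonormal basis.  The `2d`
functions `f_{t,μ}(b,c) := y_t(b, c.2)·[c.1 = μ]` are orthonormal, every product
`u_s ⊗ (p_s ⊗ q_s) = Σ_{t,μ} ⟨y_t, g_s⟩ p_s(μ) · f_{t,μ}` lies in their span, hence so does every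
output slice of `S`; the tree's `SevenEighthsLaw.stub_sliceElimination` gives
`|⟨S,T⟩|² ≤ ‖S‖² · cap f` with `cap f = Σ_{t,μ} Σ_a |Σ_m f_{t,μ}((a.1,m),(m,a.2))|² = Σ_{t,μ} Σ_a |y_t((a.1,μ),a.2)|²
= Σ_t ‖y_t‖² = d`.  (In subspace language: the product 5-plane lies in `Y ⊗ ℂ^{C1}` and the
`C1`-marginal of the target projector is `½·1`, so the capture is at most `dim Y`.)
Mathlib + the tree (`matMulTensor`, `SevenEighthsLaw.stub_sliceElimination`).
-/

set_option linter.dupNamespace false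

namespace Summit.MatrixMultiplication.MatrixMultiplication.Theorems

open scoped BigOperators ComplexConjugate InnerProductSpace
open Literature.Computability.AlgebraicComplexity

/-! ## The support frame `f_{t,μ}(b,c) = y_t(b, c.2)·[c.1 = μ]` -/

/-- Orthonormality of the support frame built from an orthonormal family `y` of functions of
`(b, ν)`. [folklore] -/
theorem rankOneSlot_frame_orthonormal {d : ℕ} (y : Fin d → (Fin 2 × Fin 2) × Fin 2 → ℂ)
    (hy : ∀ t t' : Fin d, (∑ x, conj (y t x) * y t' x) = if t = t' then 1 else 0)
    (f : Fin d × Fin 2 → (Fin 2 × Fin 2) → (Fin 2 × Fin 2) → ℂ)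
    (hf : ∀ pr b c, f pr b c = y pr.1 (b, c.2) * (if c.1 = pr.2 then 1 else 0))
    (p p' : Fin d × Fin 2) :
    (∑ b : Fin 2 × Fin 2, ∑ c : Fin 2 × Fin 2, conj (f p b c) * f p' b c) =
      if p = p' then 1 else 0 := by
  obtain ⟨t, μ⟩ := p
  obtain ⟨t', μ'⟩ := p'
  simp_rw [hf]
  have key : ∀ b : Fin 2 × Fin 2, (∑ c : Fin 2 × Fin 2,
      conj (y t (b, c.2) * (if c.1 = μ then 1 else 0)) * (y t' (b, c.2) * (if c.1 = μ' then 1 else 0)))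
        = if μ = μ' then ∑ ν : Fin 2, conj (y t (b, ν)) * y t' (b, ν) else 0 := by
    intro b
    rw [Fintype.sum_prod_type]
    simp only [Fin.sum_univ_two, Fin.isValue]
    fin_cases μ <;> fin_cases μ' <;> simp
  simp_rw [key]
  by_cases h : μ = μ'
  · subst h
    simp only [↓reduceIte, Prod.mk.injEq, and_true]
    rw [← hy t t']
    simp only [Fintype.sum_prod_type]
  · simp only [h, ↓reduceIte, Finset.sum_const_zero, Prod.mk.injEq, and_false]

/-- The capture of the support frame: `Σ_{t,μ} Σ_a |Σ_m f_{t,μ}((a.1,m),(m,a.2))|² = Σ_t ‖y_t‖²`.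
[folklore] -/
theorem rankOneSlot_frame_cap {d : ℕ} (y : Fin d → (Fin 2 × Fin 2) × Fin 2 → ℂ)
    (f : Fin d × Fin 2 → (Fin 2 × Fin 2) → (Fin 2 × Fin 2) → ℂ)
    (hf : ∀ pr b c, f pr b c = y pr.1 (b, c.2) * (if c.1 = pr.2 then 1 else 0)) :
    (∑ p : Fin d × Fin 2, ∑ a : Fin 2 × Fin 2, ‖∑ m : Fin 2, f p (a.1, m) (m, a.2)‖ ^ 2)
      = ∑ t : Fin d, ∑ x : (Fin 2 × Fin 2) × Fin 2, ‖y t x‖ ^ 2 := by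
  simp_rw [hf]
  rw [Fintype.sum_prod_type]
  refine Finset.sum_congr rfl fun t _ => ?_
  simp only [Fintype.sum_prod_type, Fin.sum_univ_two, Fin.isValue]
  simp
  ring

/-- Every product `u ⊗ (p ⊗ q)` with `u ⊗ q ∈ span y` lies in the span of the support frame.
[folklore] -/
theorem rankOneSlot_prod_mem_span {d : ℕ} (y : Fin d → (Fin 2 × Fin 2) × Fin 2 → ℂ)
    (f : Fin d × Fin 2 → (Fin 2 × Fin 2) → (Fin 2 × Fin 2) → ℂ)
    (hf : ∀ pr b c, f pr b c = y pr.1 (b, c.2) * (if c.1 = pr.2 then 1 else 0))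
    (u : (Fin 2 × Fin 2) → ℂ) (p q : Fin 2 → ℂ) (β : Fin d → ℂ)
    (hβ : ∀ x : (Fin 2 × Fin 2) × Fin 2, u x.1 * q x.2 = ∑ t, β t * y t x) :
    (fun b c => u b * (p c.1 * q c.2) : (Fin 2 × Fin 2) → (Fin 2 × Fin 2) → ℂ)
      ∈ Submodule.span ℂ (Set.range f) := by
  have hsum : (fun b c => u b * (p c.1 * q c.2) : (Fin 2 × Fin 2) → (Fin 2 × Fin 2) → ℂ)
      = ∑ pr : Fin d × Fin 2, (β pr.1 * p pr.2) • f pr := by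
    funext b c
    simp only [Finset.sum_apply, Pi.smul_apply, smul_eq_mul, hf]
    rw [Fintype.sum_prod_type]
    have hc : ∀ t : Fin d, (∑ μ : Fin 2, β t * p μ * (y t (b, c.2) * if c.1 = μ then 1 else 0))
        = β t * y t (b, c.2) * p c.1 := by
      intro t
      rw [Finset.sum_eq_single c.1]
      · simp only [↓reduceIte, mul_one]; ring
      · intro μ _ hμ; rw [if_neg (Ne.symm hμ)]; ring
      · intro h; exact absurd (Finset.mem_univ _) h
    simp_rw [hc]
    rw [← Finset.sum_mul]
    calc u b * (p c.1 * q c.2) = (u b * q c.2) * p c.1 := by ring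
      _ = (∑ t, β t * y t (b, c.2)) * p c.1 := by rw [hβ (b, c.2)]
  rw [hsum]
  exact Submodule.sum_mem _ fun pr _ => Submodule.smul_mem _ _ (Submodule.subset_span ⟨pr, rfl⟩)

/-! ## The support bound (third slot) -/

/-- **Support bound, third slot (no super-additivity on the rank-one stratum).**  If `S` is a finite
sum of triads `w_s ⊗ u_s ⊗ (p_s ⊗ q_s)` whose third factors are the rank-one matrices
`c ↦ p_s c.1 · q_s c.2`, then `|⟨S, ⟨2,2,2⟩⟩|² ≤ |σ| · ‖S‖²` — each such product captures at most one
unit of `⟨2,2,2⟩`, however the products interfere.  Proof: exact output elimination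
(`SevenEighthsLaw.stub_sliceElimination`) against the orthonormal support frame
`f_{t,μ}(b,c) = y_t(b,c.2)·[c.1 = μ]` of `Y ⊗ ℂ^{C1}`, `Y = span{(b,ν) ↦ u_s b · q_s ν}`, whose capture
is `dim Y ≤ |σ|`. [folklore] -/
theorem overlap_sq_le_card_of_rankOne_c {σ : Type*} [Fintype σ]
    (w u : σ → (Fin 2 × Fin 2) → ℂ) (p q : σ → Fin 2 → ℂ)
    (S : (Fin 2 × Fin 2) → (Fin 2 × Fin 2) → (Fin 2 × Fin 2) → ℂ)
    (hS : ∀ a b c, S a b c = ∑ s, w s a * u s b * (p s c.1 * q s c.2)) :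
    ‖∑ a, ∑ b, ∑ c, S a b c * matMulTensor ℂ 2 2 2 a b c‖ ^ 2
      ≤ (Fintype.card σ : ℝ) * ∑ a, ∑ b, ∑ c, ‖S a b c‖ ^ 2 := by
  classical
  -- the support space `Y = span{g_s}`, `g_s (b, ν) = u_s b · q_s ν`, inside a Euclidean space
  let G : σ → EuclideanSpace ℂ ((Fin 2 × Fin 2) × Fin 2) :=
    fun s => WithLp.toLp 2 fun x => u s x.1 * q s x.2
  let Y : Submodule ℂ (EuclideanSpace ℂ ((Fin 2 × Fin 2) × Fin 2)) := Submodule.span ℂ (Set.range G)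
  have hdim : Module.finrank ℂ Y ≤ Fintype.card σ := finrank_range_le_card G
  -- an orthonormal basis of `Y`, as plain functions
  let bY : OrthonormalBasis (Fin (Module.finrank ℂ Y)) ℂ Y := stdOrthonormalBasis ℂ Y
  let y : Fin (Module.finrank ℂ Y) → (Fin 2 × Fin 2) × Fin 2 → ℂ :=
    fun t x => (bY t : EuclideanSpace ℂ ((Fin 2 × Fin 2) × Fin 2)) x
  have hy : ∀ t t', (∑ x, conj (y t x) * y t' x) = if t = t' then 1 else 0 := by
    intro t t'
    rw [← orthonormal_iff_ite.mp bY.orthonormal t t', Submodule.coe_inner, PiLp.inner_apply]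
    simp only [y, RCLike.inner_apply']
  have hy1 : ∀ t, (∑ x, ‖y t x‖ ^ 2) = 1 := by
    intro t
    have h := bY.orthonormal.norm_eq_one t
    rw [Submodule.coe_norm] at h
    rw [← EuclideanSpace.norm_sq_eq, h, one_pow]
  -- coordinates of the generators in the basis
  let ψ : EuclideanSpace ℂ ((Fin 2 × Fin 2) × Fin 2) →ₗ[ℂ] ((Fin 2 × Fin 2) × Fin 2 → ℂ) :=
    { toFun := fun x i => x i
      map_add' := fun _ _ => rfl
      map_smul' := fun _ _ => rfl }
  have hexp : ∀ s, ∃ β : Fin (Module.finrank ℂ Y) → ℂ,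
      ∀ x, u s x.1 * q s x.2 = ∑ t, β t * y t x := by
    intro s
    have hGs : G s ∈ Y := Submodule.subset_span ⟨s, rfl⟩
    refine ⟨fun t => ⟪bY t, (⟨G s, hGs⟩ : Y)⟫_ℂ, fun x => ?_⟩
    have h1 := bY.sum_repr' (⟨G s, hGs⟩ : Y)
    have h2 := congrArg (fun z : Y => ψ (z : EuclideanSpace ℂ ((Fin 2 × Fin 2) × Fin 2))) h1
    simp only [Submodule.coe_sum, Submodule.coe_smul, map_sum, map_smul] at h2
    have h3 := congrFun h2 x
    simp only [Finset.sum_apply, Pi.smul_apply, smul_eq_mul] at h3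
    exact h3.symm
  choose β hβ using hexp
  -- the support frame and its reindexing by `Fin (d * 2)`
  let f : Fin (Module.finrank ℂ Y) × Fin 2 → (Fin 2 × Fin 2) → (Fin 2 × Fin 2) → ℂ :=
    fun pr b c => y pr.1 (b, c.2) * (if c.1 = pr.2 then 1 else 0)
  have hf : ∀ pr b c, f pr b c = y pr.1 (b, c.2) * (if c.1 = pr.2 then 1 else 0) :=
    fun _ _ _ => rfl
  let e : Fin (Module.finrank ℂ Y * 2) → (Fin 2 × Fin 2) → (Fin 2 × Fin 2) → ℂ :=
    fun i => f (finProdFinEquiv.symm i)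
  have he : ∀ i j, (∑ b, ∑ c, conj (e i b c) * e j b c) = if i = j then 1 else 0 := by
    intro i j
    have h := rankOneSlot_frame_orthonormal y hy f hf (finProdFinEquiv.symm i)
      (finProdFinEquiv.symm j)
    simp only [EmbeddingLike.apply_eq_iff_eq] at h
    exact h
  have hfe : Set.range e = Set.range f := by
    simp only [e]
    exact finProdFinEquiv.symm.surjective.range_comp f
  -- every product, hence every output slice of `S`, lies in the span of the frame
  have hprod : ∀ s, (fun b c => u s b * (p s c.1 * q s c.2)) ∈ Submodule.span ℂ (Set.range e) := by
    intro s
    rw [hfe]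
    exact rankOneSlot_prod_mem_span y f hf (u s) (p s) (q s) (β s) (hβ s)
  have hslices : ∀ a, S a ∈ Submodule.span ℂ (Set.range e) := by
    intro a
    have hSa : S a = ∑ s, w s a • (fun b c => u s b * (p s c.1 * q s c.2) :
        (Fin 2 × Fin 2) → (Fin 2 × Fin 2) → ℂ) := by
      funext b c
      simp only [hS, Finset.sum_apply, Pi.smul_apply, smul_eq_mul]
      exact Finset.sum_congr rfl fun s _ => by ring
    rw [hSa]
    exact Submodule.sum_mem _ fun s _ => Submodule.smul_mem _ _ (hprod s)
  -- capture of the frame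
  have hcap : (∑ i, ∑ a : Fin 2 × Fin 2, ‖∑ m : Fin 2, e i (a.1, m) (m, a.2)‖ ^ 2)
      = Module.finrank ℂ Y := by
    have h1 : (∑ i, ∑ a : Fin 2 × Fin 2, ‖∑ m : Fin 2, e i (a.1, m) (m, a.2)‖ ^ 2)
        = ∑ pr : Fin (Module.finrank ℂ Y) × Fin 2, ∑ a : Fin 2 × Fin 2,
            ‖∑ m : Fin 2, f pr (a.1, m) (m, a.2)‖ ^ 2 :=
      Fintype.sum_equiv finProdFinEquiv.symm _ _ fun i => rfl
    rw [h1, rankOneSlot_frame_cap y f hf]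
    simp_rw [hy1]
    simp
  -- output elimination
  have key := SevenEighthsLaw.stub_sliceElimination e he S hslices
  rw [hcap] at key
  have hnn : (0 : ℝ) ≤ ∑ a, ∑ b, ∑ c, ‖S a b c‖ ^ 2 := by positivity
  have hdR : ((Module.finrank ℂ Y : ℕ) : ℝ) ≤ Fintype.card σ := by exact_mod_cast hdim
  calc ‖∑ a, ∑ b, ∑ c, S a b c * matMulTensor ℂ 2 2 2 a b c‖ ^ 2
      ≤ (∑ a, ∑ b, ∑ c, ‖S a b c‖ ^ 2) * (Module.finrank ℂ Y : ℕ) := key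
    _ ≤ (∑ a, ∑ b, ∑ c, ‖S a b c‖ ^ 2) * Fintype.card σ := mul_le_mul_of_nonneg_left hdR hnn
    _ = (Fintype.card σ : ℝ) * ∑ a, ∑ b, ∑ c, ‖S a b c‖ ^ 2 := by ring

/-! ## The other two slots, by the cyclic symmetry of `⟨2,2,2⟩` -/

/-- Cyclic symmetry of `⟨2,2,2⟩` (`tr(XYZ) = tr(YZX)` with the tree's index conventions): the
relabelling `S ↦ ((a,b,c) ↦ S(b.swap, c, a.swap))` preserves the overlap with `⟨2,2,2⟩`. [folklore] -/
theorem overlap_cycle (S : (Fin 2 × Fin 2) → (Fin 2 × Fin 2) → (Fin 2 × Fin 2) → ℂ) :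
    (∑ a : Fin 2 × Fin 2, ∑ b : Fin 2 × Fin 2, ∑ c : Fin 2 × Fin 2,
        S b.swap c a.swap * matMulTensor ℂ 2 2 2 a b c)
      = ∑ a, ∑ b, ∑ c, S a b c * matMulTensor ℂ 2 2 2 a b c := by
  simp only [Fintype.sum_prod_type, Fin.sum_univ_two, matMulTensor, Prod.swap_prod_mk, Fin.isValue]
  norm_num
  ring

/-- The relabelling `S ↦ S(b.swap, c, a.swap)` preserves the norm. [folklore] -/
theorem normSq_cycle (S : (Fin 2 × Fin 2) → (Fin 2 × Fin 2) → (Fin 2 × Fin 2) → ℂ) :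
    (∑ a : Fin 2 × Fin 2, ∑ b : Fin 2 × Fin 2, ∑ c : Fin 2 × Fin 2, ‖S b.swap c a.swap‖ ^ 2)
      = ∑ a, ∑ b, ∑ c, ‖S a b c‖ ^ 2 := by
  simp only [Fintype.sum_prod_type, Fin.sum_univ_two, Prod.swap_prod_mk, Fin.isValue]
  ring

/-- **Support bound, second slot.**  If `S` is a finite sum of triads `w_s ⊗ (p_s ⊗ q_s) ⊗ v_s` whose
second factors are rank-one matrices `b ↦ p_s b.1 · q_s b.2`, then `|⟨S, ⟨2,2,2⟩⟩|² ≤ |σ| · ‖S‖²`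
(the third-slot bound applied to `S(b.swap, c, a.swap)`). [folklore] -/
theorem overlap_sq_le_card_of_rankOne_b {σ : Type*} [Fintype σ]
    (w v : σ → (Fin 2 × Fin 2) → ℂ) (p q : σ → Fin 2 → ℂ)
    (S : (Fin 2 × Fin 2) → (Fin 2 × Fin 2) → (Fin 2 × Fin 2) → ℂ)
    (hS : ∀ a b c, S a b c = ∑ s, w s a * (p s b.1 * q s b.2) * v s c) :
    ‖∑ a, ∑ b, ∑ c, S a b c * matMulTensor ℂ 2 2 2 a b c‖ ^ 2
      ≤ (Fintype.card σ : ℝ) * ∑ a, ∑ b, ∑ c, ‖S a b c‖ ^ 2 := by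
  have hS' : ∀ a b c : Fin 2 × Fin 2, S b.swap c a.swap
      = ∑ s, v s a.swap * w s b.swap * (p s c.1 * q s c.2) := by
    intro a b c
    rw [hS]
    exact Finset.sum_congr rfl fun s _ => by ring
  have h := overlap_sq_le_card_of_rankOne_c (fun s a => v s a.swap) (fun s b => w s b.swap) p q
    (fun a b c => S b.swap c a.swap) hS'
  rw [overlap_cycle S, normSq_cycle S] at h
  exact h

/-- **Support bound, output slot.**  If `S` is a finite sum of triads `(p_s ⊗ q_s) ⊗ u_s ⊗ v_s` whose
first (output) factors are rank-one matrices `a ↦ p_s a.1 · q_s a.2`, then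
`|⟨S, ⟨2,2,2⟩⟩|² ≤ |σ| · ‖S‖²` (the second-slot bound applied to `S(b.swap, c, a.swap)`). [folklore] -/
theorem overlap_sq_le_card_of_rankOne_a {σ : Type*} [Fintype σ]
    (u v : σ → (Fin 2 × Fin 2) → ℂ) (p q : σ → Fin 2 → ℂ)
    (S : (Fin 2 × Fin 2) → (Fin 2 × Fin 2) → (Fin 2 × Fin 2) → ℂ)
    (hS : ∀ a b c, S a b c = ∑ s, (p s a.1 * q s a.2) * u s b * v s c) :
    ‖∑ a, ∑ b, ∑ c, S a b c * matMulTensor ℂ 2 2 2 a b c‖ ^ 2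
      ≤ (Fintype.card σ : ℝ) * ∑ a, ∑ b, ∑ c, ‖S a b c‖ ^ 2 := by
  have hS' : ∀ a b c : Fin 2 × Fin 2, S b.swap c a.swap
      = ∑ s, v s a.swap * (q s b.1 * p s b.2) * u s c := by
    intro a b c
    rw [hS]
    simp only [Prod.fst_swap, Prod.snd_swap]
    exact Finset.sum_congr rfl fun s _ => by ring
  have h := overlap_sq_le_card_of_rankOne_b (fun s a => v s a.swap) u q p
    (fun a b c => S b.swap c a.swap) hS'
  rw [overlap_cycle S, normSq_cycle S] at h
  exact h

/-! ## Consequences for the item `SixEighthsAtFive` -/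

/-- Splitting one `2 × 2` matrix into its two rows (two rank-one pieces): for `v : Fin 2 × Fin 2 → ℂ`,
`v c = Σ_m [c.1 = m] · v (m, c.2)`. [folklore] -/
theorem rankOneSlot_split_rows (v : Fin 2 × Fin 2 → ℂ) (c : Fin 2 × Fin 2) :
    v c = ∑ m : Fin 2, (if c.1 = m then 1 else 0) * v (m, c.2) := by
  obtain ⟨c1, c2⟩ := c
  fin_cases c1 <;> simp

/-- **`SixEighthsAtFive` for decompositions with at most one full-rank factor in the third slot.**
If `S = Σ_{l<5} w_l ⊗ u_l ⊗ v_l` and all `v_l` but possibly `v_{l₀}` are rank-one matrices, then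
`|⟨S, ⟨2,2,2⟩⟩|² ≤ 6 · ‖S‖²` — the item's inequality, with the item's constant: count `4·1 + 2 = 6`
rank-one pieces and apply `overlap_sq_le_card_of_rankOne_c`.  Bini's honest family (four rank-one
factors and one of rank two in a slot) shows the constant `6` is sharp here. [folklore] -/
theorem sixEighthsAtFive_of_atMostOneFullRank_c
    (S : (Fin 2 × Fin 2) → (Fin 2 × Fin 2) → (Fin 2 × Fin 2) → ℂ)
    (w u v : Fin 5 → (Fin 2 × Fin 2) → ℂ) (hS : S = ∑ l, triad (w l) (u l) (v l)) (l₀ : Fin 5)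
    (hv : ∀ l, l ≠ l₀ → ∃ p q : Fin 2 → ℂ, ∀ c, v l c = p c.1 * q c.2) :
    ‖∑ a, ∑ b, ∑ c, S a b c * matMulTensor ℂ 2 2 2 a b c‖ ^ 2
      ≤ 6 * ∑ a, ∑ b, ∑ c, ‖S a b c‖ ^ 2 := by
  classical
  have hv' : ∀ i : Fin 4, ∃ p q : Fin 2 → ℂ, ∀ c, v (l₀.succAbove i) c = p c.1 * q c.2 :=
    fun i => hv _ (Fin.succAbove_ne l₀ i)
  choose p q hpq using hv'
  -- index the six rank-one pieces by `Fin 4 ⊕ Fin 2`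
  let w' : Fin 4 ⊕ Fin 2 → (Fin 2 × Fin 2) → ℂ := Sum.elim (fun i => w (l₀.succAbove i)) fun _ => w l₀
  let u' : Fin 4 ⊕ Fin 2 → (Fin 2 × Fin 2) → ℂ := Sum.elim (fun i => u (l₀.succAbove i)) fun _ => u l₀
  let p' : Fin 4 ⊕ Fin 2 → Fin 2 → ℂ := Sum.elim p fun m c1 => if c1 = m then 1 else 0
  let q' : Fin 4 ⊕ Fin 2 → Fin 2 → ℂ := Sum.elim q fun m c2 => v l₀ (m, c2)
  have hS' : ∀ a b c, S a b c = ∑ s, w' s a * u' s b * (p' s c.1 * q' s c.2) := by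
    intro a b c
    rw [hS, Finset.sum_apply, Finset.sum_apply, Finset.sum_apply, Fin.sum_univ_succAbove _ l₀,
      Fintype.sum_sum_type]
    simp only [triad_apply, w', u', p', q', Sum.elim_inl, Sum.elim_inr]
    rw [add_comm]
    congr 1
    · exact Finset.sum_congr rfl fun i _ => by rw [hpq i c]
    · rw [rankOneSlot_split_rows (v l₀) c, Finset.mul_sum]
  have h := overlap_sq_le_card_of_rankOne_c w' u' p' q' S hS'
  have hcard : (Fintype.card (Fin 4 ⊕ Fin 2) : ℝ) = 6 := by simp
  rwa [hcard] at h

/-- **`SixEighthsAtFive` for decompositions with at most one full-rank factor in the second slot.**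
[folklore] -/
theorem sixEighthsAtFive_of_atMostOneFullRank_b
    (S : (Fin 2 × Fin 2) → (Fin 2 × Fin 2) → (Fin 2 × Fin 2) → ℂ)
    (w u v : Fin 5 → (Fin 2 × Fin 2) → ℂ) (hS : S = ∑ l, triad (w l) (u l) (v l)) (l₀ : Fin 5)
    (hu : ∀ l, l ≠ l₀ → ∃ p q : Fin 2 → ℂ, ∀ b, u l b = p b.1 * q b.2) :
    ‖∑ a, ∑ b, ∑ c, S a b c * matMulTensor ℂ 2 2 2 a b c‖ ^ 2
      ≤ 6 * ∑ a, ∑ b, ∑ c, ‖S a b c‖ ^ 2 := by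
  classical
  have hu' : ∀ i : Fin 4, ∃ p q : Fin 2 → ℂ, ∀ b, u (l₀.succAbove i) b = p b.1 * q b.2 :=
    fun i => hu _ (Fin.succAbove_ne l₀ i)
  choose p q hpq using hu'
  let w' : Fin 4 ⊕ Fin 2 → (Fin 2 × Fin 2) → ℂ := Sum.elim (fun i => w (l₀.succAbove i)) fun _ => w l₀
  let v' : Fin 4 ⊕ Fin 2 → (Fin 2 × Fin 2) → ℂ := Sum.elim (fun i => v (l₀.succAbove i)) fun _ => v l₀
  let p' : Fin 4 ⊕ Fin 2 → Fin 2 → ℂ := Sum.elim p fun m b1 => if b1 = m then 1 else 0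
  let q' : Fin 4 ⊕ Fin 2 → Fin 2 → ℂ := Sum.elim q fun m b2 => u l₀ (m, b2)
  have hS' : ∀ a b c, S a b c = ∑ s, w' s a * (p' s b.1 * q' s b.2) * v' s c := by
    intro a b c
    rw [hS, Finset.sum_apply, Finset.sum_apply, Finset.sum_apply, Fin.sum_univ_succAbove _ l₀,
      Fintype.sum_sum_type]
    simp only [triad_apply, w', v', p', q', Sum.elim_inl, Sum.elim_inr]
    rw [add_comm]
    congr 1
    · exact Finset.sum_congr rfl fun i _ => by rw [hpq i b]
    · rw [rankOneSlot_split_rows (u l₀) b, Finset.mul_sum, Finset.sum_mul]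
  have h := overlap_sq_le_card_of_rankOne_b w' v' p' q' S hS'
  have hcard : (Fintype.card (Fin 4 ⊕ Fin 2) : ℝ) = 6 := by simp
  rwa [hcard] at h

/-- **`SixEighthsAtFive` for decompositions with at most one full-rank factor in the output slot.**
[folklore] -/
theorem sixEighthsAtFive_of_atMostOneFullRank_a
    (S : (Fin 2 × Fin 2) → (Fin 2 × Fin 2) → (Fin 2 × Fin 2) → ℂ)
    (w u v : Fin 5 → (Fin 2 × Fin 2) → ℂ) (hS : S = ∑ l, triad (w l) (u l) (v l)) (l₀ : Fin 5)
    (hw : ∀ l, l ≠ l₀ → ∃ p q : Fin 2 → ℂ, ∀ a, w l a = p a.1 * q a.2) :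
    ‖∑ a, ∑ b, ∑ c, S a b c * matMulTensor ℂ 2 2 2 a b c‖ ^ 2
      ≤ 6 * ∑ a, ∑ b, ∑ c, ‖S a b c‖ ^ 2 := by
  classical
  have hw' : ∀ i : Fin 4, ∃ p q : Fin 2 → ℂ, ∀ a, w (l₀.succAbove i) a = p a.1 * q a.2 :=
    fun i => hw _ (Fin.succAbove_ne l₀ i)
  choose p q hpq using hw'
  let u' : Fin 4 ⊕ Fin 2 → (Fin 2 × Fin 2) → ℂ := Sum.elim (fun i => u (l₀.succAbove i)) fun _ => u l₀
  let v' : Fin 4 ⊕ Fin 2 → (Fin 2 × Fin 2) → ℂ := Sum.elim (fun i => v (l₀.succAbove i)) fun _ => v l₀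
  let p' : Fin 4 ⊕ Fin 2 → Fin 2 → ℂ := Sum.elim p fun m a1 => if a1 = m then 1 else 0
  let q' : Fin 4 ⊕ Fin 2 → Fin 2 → ℂ := Sum.elim q fun m a2 => w l₀ (m, a2)
  have hS' : ∀ a b c, S a b c = ∑ s, (p' s a.1 * q' s a.2) * u' s b * v' s c := by
    intro a b c
    rw [hS, Finset.sum_apply, Finset.sum_apply, Finset.sum_apply, Fin.sum_univ_succAbove _ l₀,
      Fintype.sum_sum_type]
    simp only [triad_apply, u', v', p', q', Sum.elim_inl, Sum.elim_inr]
    rw [add_comm]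
    congr 1
    · exact Finset.sum_congr rfl fun i _ => by rw [hpq i a]
    · rw [rankOneSlot_split_rows (w l₀) a, Finset.sum_mul, Finset.sum_mul]
  have h := overlap_sq_le_card_of_rankOne_a u' v' p' q' S hS'
  have hcard : (Fintype.card (Fin 4 ⊕ Fin 2) : ℝ) = 6 := by simp
  rwa [hcard] at h

end Summit.MatrixMultiplication.MatrixMultiplication.Theorems
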